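import Summits.BirchSwinnertonDyer.BirchSwinnertonDyer.Theorems.QuadraticBranchSignedControlPlusEtaNonsurjConjADoorUnitBSD
import Summits.BirchSwinnertonDyer.Rank1Residual.Additive.QuadraticBranchEvenValueIdentity
import HarnessLib

/-!
# Route `QuadraticBranchSignedControl` (rung K8, cell `bsd-potss`), residual crux `PlusEtaMainConjectureNonsurj`
# (stmt-BirchSwinnertonDyer-19606): THE UNIT-ROW DOOR IN `BSD` CURRENCY — the unit certificate from the rational number `L(W,1)/Ω_W`
# (seat `bsd-potss-k8eta-c2` g22, sequel of `…ConjADoorUnit` / `…ConjADoorUnitBSD`)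

WHY. The unit-row door (p715862) and its composition to `MissingPPartAt` (p717939) display the hypothesis «every function with the interpolation
property of `L_p⁺(V,η,T)` is a unit of `Λ`» — certified by PARI's `ellpadiclambdamu` (`λ⁺ = μ⁺ = 0`). The cell's VALUE IDENTITY (ctrl,
`valuation_constantCoeff_eq_padicValRat_of_twist`: for ANY period-normalised branch function `L`, `v_p(L(0)) = v_p(L(W,1)/Ω_W)`) converts it
into the classical BSD-side datum: `L` is a unit of `Λ = ℤ_p⟦T⟧` iff its constant coefficient is a `p`-adic unit iff `v_p(L(W,1)/Ω_W) = 0` (with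
`L(W,1) ≠ 0`). So the unit rows are EXACTLY the rank-0 partners with `p ∤ L(W,1)/Ω_W` — by BSD(W) `= #Ш_an·Tam/#tors²` — i.e. the rows OUTSIDE the
cell's residue table (`p ∣ #Ш_an·Tam`), and the door needs only the rational number `L(W,1)/Ω_W` (Cremona-style data: `ellL1`, `omega`).

WHAT. §1 `isUnit_of_padicValRat_lvalue_eq_zero` — a branch function is a unit when `v_p(L(W,1)/Ω_W) = 0` and `L(W,1) ≠ 0` (value identity +
`PowerSeries.isUnit_iff_constantCoeff` + `PadicInt.isUnit_iff`). §2 `quadraticBranchPlusEtaMainConjectureAt_of_conjA_of_lvalue`,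
`missingPPartAt_of_conjA_of_lvalue` — the unit-row door and its `BSD_p` composition with the unit certificate replaced by the displayed rational
`q = L(W,1)/Ω_W` with `v_p(q) = 0` (+ modularity `hmod` for the value identity; `r_an(W) = 0` gives `L(W,1) ≠ 0`).

HONEST FRAMING (cell `bsd-potss`; FULL-BSD rank ≤ 1 programme, HUMAN RULING D-0036/D-0074): TOOL THEOREMS ONLY — no definition, no named fact minted,
no `sorry`, axioms standard; CONDITIONAL on the displayed named facts and per-row data. No stub of 19606 is proved; crux and route OPEN; nothing
booked; `BSD(W,p)` asserted for no pair. `--supports stmt-BirchSwinnertonDyer-19606`.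

References: [Kobayashi2003] (3.6) (p. 7), §4 (p. 8), Thm. 2.2, 4.1; [MazurTateTeitelbaum1986Invent] §I.8 (8.6); [CoatesSujatha2005] §3 (A);
[Miller2011LMS] Def. 1.1; [Washington1997] §7.1 (units of Λ).
-/

set_option autoImplicit false
set_option linter.dupNamespace false
noncomputable section

open scoped Classical MatrixGroups ModularForm

open CongruenceSubgroup NumberField Field WeierstrassCurve
open Literature.NumberTheory.EllipticCurves Literature.NumberTheory.EllipticCurves.ModularForms
  Literature.NumberTheory.EllipticCurves.Rank1Residual Literature.NumberTheory.EllipticCurves.Rank1Residual.Typed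
  Literature.NumberTheory.GaloisRepresentations Literature.NumberTheory.GaloisCohomology
  Literature.NumberTheory.EllipticCurves.GreenbergVatsal2000 ZpExtension
open Summit.BirchSwinnertonDyer.Rank1Residual Summit.BirchSwinnertonDyer.Rank1Residual.Additive
open Summit.BirchSwinnertonDyer.BirchSwinnertonDyer.Theorems

namespace Summit.BirchSwinnertonDyer.BirchSwinnertonDyer.Theorems.EtaConjADoorUnit

variable (W : WeierstrassCurve ℚ) [W.IsElliptic] [W.IsGloballyMinimal] (p : ℕ) [hp : Fact p.Prime]

/-! ## §1 The unit certificate from `v_p(L(W,1)/Ω_W) = 0` -/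

/-- **A branch function `L_p⁺(V,η,T)` is a UNIT of `Λ` when `L(W,1)/Ω_W` is a `p`-adic unit.** `W` globally minimal, `p` odd, `V` a globally
minimal model of `W^{(p*)}` good at `p`, `f` the newform of `V`, `ϖ` the period ratio of the parity of `η`, `L` with the interpolation property,
`L(W,1)/Ω_W = q ∈ ℚ` with `v_p(q) = 0` and `L(W,1) ≠ 0`. The cell's value identity gives `v_p(L(0)) = v_p(q) = 0` and `L(0) ≠ 0`, so the
constant coefficient is a unit of `ℤ_p` (`PadicInt.isUnit_iff`, `norm_eq_zpow_neg_valuation`) and `L` is a unit of `ℤ_p⟦T⟧`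
(`PowerSeries.isUnit_iff_constantCoeff`). CONDITIONAL on modularity `hmod` (the value identity); nothing booked.
[cite: Kobayashi2003, (3.6) (p. 7)] [cite: MazurTateTeitelbaum1986Invent, §I.8 (8.6)] [cite: Washington1997, §7.1] -/
theorem isUnit_of_padicValRat_lvalue_eq_zero (hmod : hasEntireLFunction_rat) (hp2 : p ≠ 2)
    (V : WeierstrassCurve ℚ) [V.IsElliptic] [V.IsGloballyMinimal] (C : VariableChange ℚ)
    (hCV : C • W.quadraticTwist ((-1) ^ (p / 2) * p) = V) (hgood : V.HasGoodReductionAtPrime p)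
    {N : ℕ} [NeZero N] {f : CuspForm (Gamma0 N) 2} (hf : IsNewformOf V f) {ϖ : ℚ}
    (hϖ : if Even (p / 2) then (ϖ : ℝ) * V.realPeriodRat = plusPeriod f
      else (ϖ : ℝ) * V.imaginaryPeriodRat = minusPeriod f)
    {L : IwasawaAlgebra p} (hL : IsQuadraticBranchPlusLFunction f p ϖ L)
    {q : ℚ} (hq : W.entireLFunction 1 / (W.realPeriodRat : ℂ) = (q : ℂ)) (hvq : padicValRat p q = 0)
    (hLW : W.entireLFunction 1 ≠ 0) : IsUnit L := by
  obtain ⟨hval, hne⟩ := valuation_constantCoeff_eq_padicValRat_of_twist (p := p) hmod hp2 W V C hCV hgood hf hϖ hL hq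
  have h0 : PowerSeries.constantCoeff L ≠ 0 := hne hLW
  rw [PowerSeries.isUnit_iff_constantCoeff, PadicInt.isUnit_iff,
    PadicInt.norm_eq_zpow_neg_valuation h0]
  have hv : ((PowerSeries.constantCoeff L : ℤ_[p]).valuation : ℤ) = 0 := by
    rw [← PadicInt.valuation_coe, hval, hvq]
  rw [hv, neg_zero, zpow_zero]

/-! ## §2 The unit-row door and its `BSD_p` composition, with the rational `L(W,1)/Ω_W` displayed -/

omit [W.IsGloballyMinimal] in
/-- Helper: `r_an(W) = 0 ⟹ L(W,1) ≠ 0` (modularity for the order of vanishing). [cite: Miller2011LMS, §1] -/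
theorem entireLFunction_one_ne_zero_of_analyticRank_eq_zero (hmod : hasEntireLFunction_rat) (hr0 : W.analyticRank = 0) :
    W.entireLFunction 1 ≠ 0 := by
  rw [← W.leadingLCoeff_eq_of_analyticRank_eq_zero hr0]
  exact W.leadingLCoeff_ne_zero_holds (hmod W)

/-- **(C1⁺_η) on a UNIT row from (A)(W,p) and the rational number `L(W,1)/Ω_W`** (`v_p = 0`, `r_an(W) = 0`): the unit-row door
`quadraticBranchPlusEtaMainConjectureAt_of_conjA_of_isUnit` (p715862) with the unit certificate supplied by §1 for EVERY period-normalised branch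
function. Named facts `hmod h22 h41 h6273`; displayed: (A)(W,p), `q = L(W,1)/Ω_W` with `v_p(q) = 0`, `r_an(W) = 0`. CONDITIONAL; nothing booked.
[cite: Kobayashi2003, (3.6) (p. 7), §4 and Thm. 4.1 (p. 8), Thm. 2.2 (p. 5)] [cite: CoatesSujatha2005, §3 statement (A)] -/
theorem quadraticBranchPlusEtaMainConjectureAt_of_conjA_of_lvalue
    (hmod : hasEntireLFunction_rat)
    (h22 : Kobayashi2003.thm22_etaSignedSelmerDual_finite_torsion)
    (h41 : Kobayashi2003.thm41_plusEtaCharIdeal_dvd)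
    (h6273 : Kobayashi2003.thm62_63_73_etaColemanPoitouTate)
    (hp5 : 5 ≤ p) (V : WeierstrassCurve ℚ) [V.IsElliptic] [V.IsGloballyMinimal] (C : VariableChange ℚ)
    (hCV : C • W.quadraticTwist ((-1) ^ (p / 2) * p) = V) (hgood : V.HasGoodReductionAtPrime p)
    (hA : ∀ (κ : ZpExtension ℚ p), κ.IsCyclotomic →
      ∃ (γ : absoluteGaloisGroup ℚ) (D : W.FineSelmerDualData κ γ),
        Module.Finite ℤ_[p] (RestrictScalars ℤ_[p] (IwasawaAlgebra p) D.X))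
    {q : ℚ} (hq : W.entireLFunction 1 / (W.realPeriodRat : ℂ) = (q : ℂ)) (hvq : padicValRat p q = 0)
    (hr0 : W.analyticRank = 0) :
    QuadraticBranchPlusEtaMainConjectureAt V p :=
  quadraticBranchPlusEtaMainConjectureAt_of_conjA_of_isUnit p W h22 h41 h6273 V C hCV hA
    (fun hf ϖ hϖ Lη hL => isUnit_of_padicValRat_lvalue_eq_zero W p hmod (by omega) V C hCV hgood hf hϖ hL hq hvq
      (entireLFunction_one_ne_zero_of_analyticRank_eq_zero W hmod hr0))

/-- **`MissingPPartAt W p` — `ord_p #Ш(W) = ord_p #Ш_an(W)` — on a UNIT row from (A)(W,p) and the rational `L(W,1)/Ω_W`** (`v_p = 0`,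
`r_an(W) = 0`): §2 then p717939's `EtaConjADoorUnitBSD.missingPPartAt_of_plusEtaMainConjectureAt_of_analyticRank_eq_zero`. Named facts
`hGZK hmod hnf hM h12 hKO h22 h41 h6273`. CONDITIONAL; nothing booked. [cite: Kobayashi2003, Thm. 1.2, §4, Thm. 9.3] [cite: Miller2011LMS, Def. 1.1]
[cite: CoatesSujatha2005, §3 statement (A)] -/
theorem missingPPartAt_of_conjA_of_lvalue
    (hGZK : rank_eq_analyticRank_of_analyticRank_le_one) (hmod : hasEntireLFunction_rat)
    (hnf : exists_isNewformOf) (hM : mazur_not_dvd_maninConstant_of_odd)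
    (h12 : Kobayashi2003.thm12_signedSelmerDual_finite_torsion)
    (hKO : KitajimaOtsuki2018.mainThm13_etaSignedSelmerDual_noFiniteSubmodule)
    (h22 : Kobayashi2003.thm22_etaSignedSelmerDual_finite_torsion)
    (h41 : Kobayashi2003.thm41_plusEtaCharIdeal_dvd)
    (h6273 : Kobayashi2003.thm62_63_73_etaColemanPoitouTate)
    (hp5 : 5 ≤ p) (V : WeierstrassCurve ℚ) [V.IsElliptic] [V.IsGloballyMinimal] (C : VariableChange ℚ)
    (hCV : C • W.quadraticTwist ((-1) ^ (p / 2) * p) = V)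
    (hgood : V.HasGoodReductionAtPrime p) (hap : V.frobeniusTrace p = 0)
    (hA : ∀ (κ : ZpExtension ℚ p), κ.IsCyclotomic →
      ∃ (γ : absoluteGaloisGroup ℚ) (D : W.FineSelmerDualData κ γ),
        Module.Finite ℤ_[p] (RestrictScalars ℤ_[p] (IwasawaAlgebra p) D.X))
    {q : ℚ} (hq : W.entireLFunction 1 / (W.realPeriodRat : ℂ) = (q : ℂ)) (hvq : padicValRat p q = 0)
    (hr0 : W.analyticRank = 0) :
    MissingPPartAt W p :=
  EtaConjADoorUnitBSD.missingPPartAt_of_plusEtaMainConjectureAt_of_analyticRank_eq_zero W p hGZK hmod hnf hM h12 hKO hp5 V C hCV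
    hgood hap (quadraticBranchPlusEtaMainConjectureAt_of_conjA_of_lvalue W p hmod h22 h41 h6273 hp5 V C hCV hgood hA hq hvq hr0) hr0

end Summit.BirchSwinnertonDyer.BirchSwinnertonDyer.Theorems.EtaConjADoorUnit

end
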